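import Summits.CriticalPhenomena.PercolationContinuityZ3.Theorems.PercNearOneGluingNoHeavyLowerTailSunflowerFlipPurePayer
import Summits.CriticalPhenomena.PercolationContinuityZ3.Theorems.PercNearOneGluingNoHeavyLowerTailSunflowerMultiPetalHomeRouting
import HarnessLib

/-!
# `NoHeavyLowerTail` (crux stmt-CriticalPhenomena-4575), abstract sunflower cubic: LINK between the three-petal flipped functional `ZHflip`
# (`…SunflowerFlipPurePayer`, prim-ineq-gen-2 gen 29) and prim-l12-p2's multi-petal flip `MSunflower.ZKflip` (Conjecture G, `FlipPartitionLemmaK`)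

Support file (seat `prim-ineq-gen-2` gen 29; `--supports stmt-CriticalPhenomena-4575`).  No `sorry`, no new definitions.

* `MSunflower.ZKflip_ofSunflower` — `(ofSunflower F).ZKflip D = F.ZHflip D` (as `ZK_ofSunflower` for `D = ∅`).
* `ZHflip_nonneg_of_flipPartitionLemmaK` — prim-l12-p2's Conjecture G (`FlipPartitionLemmaK`) gives `0 ≤ F.ZHflip D` for every three-petal sunflower.
(The converse direction through `FlipPurePayer` is moot: that dichotomy is refuted, `…SunflowerFlipPurePayerRefutation.not_flipPurePayer`.)
-/

namespace Summit.CriticalPhenomena.PercolationContinuityZ3.Theorems.SunflowerPartition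

open Finset

variable {α : Type*} [DecidableEq α] [Fintype α]

namespace MSunflower

/-- `ZKflip (ofSunflower F) D = ZHflip F D`: the two flipped partition functionals agree on three-petal sunflowers. [this work] -/
theorem ZKflip_ofSunflower (F : Sunflower α) (D : Finset α) : (ofSunflower F).ZKflip D = F.ZHflip D := by
  unfold ZKflip Sunflower.ZHflip
  refine sum_congr rfl fun q _ => ?_
  rw [lab_ofSunflower, lab_ofSunflower, lab_ofSunflower, s6K_three]

end MSunflower

/-- **Conjecture G ⟹ `ZHflip ≥ 0`**: prim-l12-p2's `FlipPartitionLemmaK` contains the three-petal flipped partition lemma. [this work] -/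
theorem ZHflip_nonneg_of_flipPartitionLemmaK (h : FlipPartitionLemmaK) {α : Type} [Fintype α] [DecidableEq α]
    (F : Sunflower α) (D : Finset α) : 0 ≤ F.ZHflip D := by
  rw [← MSunflower.ZKflip_ofSunflower]
  exact h 3 α (MSunflower.ofSunflower F) D

end Summit.CriticalPhenomena.PercolationContinuityZ3.Theorems.SunflowerPartition
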